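import Literature.NumberTheory.QuadraticFields.InfrastructureReduction
import HarnessLib

/-!
# The fundamental unit of `ℚ(√d)` as the least unit pair `(a, b)`, `a² - db² = ±4`

Topic `NumberTheory/QuadraticFields` (the infrastructure of a real quadratic order, VII). The link
between the arithmetic description of units used by the tree's cryptography facts
(`Literature/Computability/Cryptography/HallgrenPell.lean`: the fundamental unit of `ℚ(√d)`, `d ≥ 2`
squarefree, is `ε₀ = (a + b√d)/2` with `a, b ∈ ℕ`, `b > 0`, `a² - db² = ±4` and `a` least) and the
coordinate model `𝒪_Δ ↪ ℤ²` of `InfrastructureMinima.lean` (`Δ = disc d = d` or `4d`):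

* `disc d` is a fundamental discriminant `≥ 5` (`disc_isFundDisc`, `disc_isDisc`), with
  `√Δ = √d` resp. `2√d`;
* `pair_of_unit` — every unit `u > 1` of `𝒪_Δ` is `(x + y√d)/2` with `x, y ≥ 1`, `x² - dy² = ±4`
  (Jacobson–Williams §1.? / the tree's `RealQuadraticUnits.exists_sq_sub_eq_of_one_lt`);
* `unit_of_pair` — conversely such a pair gives a unit of `𝒪_Δ` (parity: `a ≡ b (mod 2)` when
  `d ≡ 1 (mod 4)`, `a, b` even when `d ≡ 2, 3 (mod 4)`);
* `lt_trace_of_mul` — traces grow strictly under multiplication by a unit `> 1`: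
  if `2a₀ = a'x + db'y` with unit pairs `(a', b')`, `(x, y)` then `a' < a₀` (elementary; the only
  delicate case `x = 1` forces `d = 5`, `y = 1`);
* `least_of_least_trace` — hence **the unit with the least `a` is the least unit `> 1`**, i.e. the
  fundamental unit `ε₀`, and `log ε₀` is the regulator walked by the infrastructure.

Everything is proved; no named facts.

## References

* M. J. Jacobson, Jr., H. C. Williams, *Solving the Pell Equation*, CMS Books in Mathematics, Springer
  (2009), §4.1 (`Δ_K`, `𝒪_K`), §1.3–1.4 (units `(x + y√d)/2`, `x² - dy² = ±4`, fundamental unit).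
  [JacobsonWilliams2008]
-/

noncomputable section

open scoped Classical

namespace Literature.NumberTheory.QuadraticFields.Infra

/-! ### The discriminant of `ℚ(√d)` -/

/-- `Δ = d` if `d ≡ 1 (mod 4)`, else `Δ = 4d`. [cite: JacobsonWilliams2008, §4.1 (Δ_K)] -/
def disc (d : ℕ) : ℕ := if d % 4 = 1 then d else 4 * d

/-- The factor `√Δ/√d ∈ {1, 2}`. [folklore] -/
def discK (d : ℕ) : ℕ := if d % 4 = 1 then 1 else 2

variable {d : ℕ}

/-- A squarefree number is not divisible by `4`. [folklore] -/
theorem mod_four_ne_zero (hd : Squarefree d) : d % 4 ≠ 0 := by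
  intro h
  have h4 : 2 * 2 ∣ d := ⟨d / 4, by omega⟩
  have := hd 2 h4
  simp at this

/-- `disc d` is a fundamental discriminant for squarefree `d ≥ 2`. [cite: JacobsonWilliams2008, §4.1] -/
theorem disc_isFundDisc (hd : Squarefree d) (h2 : 2 ≤ d) : IsFundDisc (disc d) := by
  unfold disc
  split_ifs with h
  · exact Or.inl ⟨hd, h, by omega⟩
  · right
    have := mod_four_ne_zero hd
    exact ⟨d, rfl, hd, by omega⟩

/-- `disc d ≥ 5` for squarefree `d ≥ 2`. [folklore] -/
theorem five_le_disc (h2 : 2 ≤ d) : 5 ≤ disc d := by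
  unfold disc
  split_ifs with h
  · omega
  · omega

/-- A fundamental discriminant `≥ 5` is admissible (`≡ 0, 1 (mod 4)`, not a square: a squarefree
square is `1`, and `4d = k²` forces `d = (k/2)²`). [cite: JacobsonWilliams2008, §4.1] -/
theorem IsFundDisc.isDisc {Δ : ℕ} (h : IsFundDisc Δ) (h5 : 5 ≤ Δ) : IsDisc Δ := by
  rcases h with ⟨hsf, h1, _⟩ | ⟨d', rfl, hsf, hd'⟩
  · refine ⟨Or.inr h1, fun ⟨k, hk⟩ => ?_⟩
    have hk1 := Nat.isUnit_iff.mp (hsf k ⟨1, by rw [hk, mul_one]⟩)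
    subst hk1; omega
  · refine ⟨Or.inl (by omega), fun ⟨k, hk⟩ => ?_⟩
    have h2k : 2 ∣ k := by
      have : 2 ∣ k * k := ⟨2 * d', by omega⟩
      exact (Nat.Prime.dvd_mul Nat.prime_two).mp this |>.elim id id
    obtain ⟨j, rfl⟩ := h2k
    have hd : d' = j * j := by nlinarith
    have hj1 := Nat.isUnit_iff.mp (hsf j ⟨1, by rw [hd, mul_one]⟩)
    subst hj1; omega

/-- `disc d` is admissible discriminant data. [cite: JacobsonWilliams2008, §4.1] -/
theorem disc_isDisc (hd : Squarefree d) (h2 : 2 ≤ d) : IsDisc (disc d) :=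
  IsFundDisc.isDisc (disc_isFundDisc hd h2) (five_le_disc h2)

/-- `σ(disc d) = 1` if `d ≡ 1 (mod 4)`, else `0`. [folklore] -/
theorem sig_disc (d : ℕ) : sig (disc d) = if d % 4 = 1 then 1 else 0 := by
  unfold sig disc
  split_ifs with h <;> simp <;> omega

/-- `√(disc d) = discK d · √d`. [folklore] -/
theorem rt_disc (d : ℕ) : rt (disc d) = discK d * Real.sqrt d := by
  unfold rt disc discK
  split_ifs with h
  · simp
  · push_cast
    rw [show ((4 : ℝ) * d) = (2 : ℝ) ^ 2 * d by ring, Real.sqrt_mul (by positivity), Real.sqrt_sq (by norm_num)]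

/-- `4 c_ω(disc d) = disc d - σ`, i.e. `c_ω = (d-1)/4` resp. `d`. [folklore] -/
theorem cw_disc (hd : Squarefree d) (h2 : 2 ≤ d) : 4 * cw (disc d) = (disc d : ℤ) - sig (disc d) :=
  four_mul_cw (disc_isDisc hd h2)

/-! ### Units as pairs `(x, y)`, `x² - dy² = ±4` -/

/-- The pair equation `x² - dy² = ±4`. [cite: JacobsonWilliams2008, §1.3 (x² - dy² = ±4)] -/
def IsUnitPair (d : ℕ) (x y : ℤ) : Prop := x ^ 2 - d * y ^ 2 = 4 ∨ x ^ 2 - d * y ^ 2 = -4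

/-- The `X`-coordinate `2p₁ + σp₂` of `ev p = (X + Y√d)/2`. [folklore] -/
def pairX (d : ℕ) (p : ℤ × ℤ) : ℤ := 2 * p.1 + sig (disc d) * p.2

/-- The `Y`-coordinate `discK · p₂` of `ev p = (X + Y√d)/2`. [folklore] -/
def pairY (d : ℕ) (p : ℤ × ℤ) : ℤ := discK d * p.2

/-- `ev (√Δ) p = (X + Y√d)/2`. [folklore] -/
theorem ev_eq_pair (d : ℕ) (p : ℤ × ℤ) :
    ev (disc d) (rt (disc d)) p = (pairX d p + pairY d p * Real.sqrt d) / 2 := by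
  unfold ev pairX pairY
  rw [rt_disc]
  push_cast
  ring

/-- `ev (-√Δ) p = (X - Y√d)/2`. [folklore] -/
theorem ev_neg_eq_pair (d : ℕ) (p : ℤ × ℤ) :
    ev (disc d) (-rt (disc d)) p = (pairX d p - pairY d p * Real.sqrt d) / 2 := by
  unfold ev pairX pairY
  rw [rt_disc]
  push_cast
  ring

/-- `X² - dY² = 4N(p)`. [cite: JacobsonWilliams2008, §1.3] -/
theorem pair_norm (hd : Squarefree d) (h2 : 2 ≤ d) (p : ℤ × ℤ) :
    pairX d p ^ 2 - d * pairY d p ^ 2 = 4 * Nm (disc d) p := by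
  have h4 := cw_disc hd h2
  have hs := sig_disc d
  unfold pairX pairY Nm discK
  unfold disc at h4 hs ⊢
  split_ifs at h4 hs ⊢ with h
  · rw [hs] at h4 ⊢; push_cast at h4 ⊢; linear_combination (p.2 ^ 2) * h4
  · rw [hs] at h4 ⊢; push_cast at h4 ⊢; linear_combination (p.2 ^ 2) * h4

/-- `p · p̄ = (N(p), 0)` in coordinates, `p̄ = (p₁ + σp₂, -p₂)`. [cite: JacobsonWilliams2008, §4.1 (conjugate)] -/
theorem omul_conj (Δ : ℕ) (p : ℤ × ℤ) : omul Δ p (p.1 + sig Δ * p.2, -p.2) = (Nm Δ p, 0) := by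
  unfold omul Nm; ext <;> simp only <;> ring

/-- An element of norm `±1` is a unit. [cite: JacobsonWilliams2008, §4.1 (units)] -/
theorem isUnitO_of_nm {Δ : ℕ} {p : ℤ × ℤ} (h : Nm Δ p = 1 ∨ Nm Δ p = -1) : IsUnitO Δ p := by
  refine ⟨(Nm Δ p * (p.1 + sig Δ * p.2), Nm Δ p * (-p.2)), ?_⟩
  have key : omul Δ p (Nm Δ p * (p.1 + sig Δ * p.2), Nm Δ p * (-p.2)) =
      (Nm Δ p * Nm Δ p, 0) := by
    have := omul_conj Δ p
    unfold omul Nm at this ⊢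
    simp only [Prod.mk.injEq] at this ⊢
    obtain ⟨h1, h2⟩ := this
    constructor
    · linear_combination (Nm Δ p) * h1
    · linear_combination (Nm Δ p) * h2
  rw [key]
  rcases h with h | h <;> simp [h]

/-- A unit has norm `±1`. [cite: JacobsonWilliams2008, §4.1 (units)] -/
theorem IsUnitO.nm_eq {Δ : ℕ} (hΔ : IsDisc Δ) {p : ℤ × ℤ} (h : IsUnitO Δ p) : Nm Δ p = 1 ∨ Nm Δ p = -1 := by
  obtain ⟨q, h1, h2⟩ := h.exists_inv hΔ
  have hN : (Nm Δ p : ℝ) * Nm Δ q = 1 := by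
    rw [← ev_mul_ev_neg hΔ, ← ev_mul_ev_neg hΔ]
    linear_combination (ev Δ (-rt Δ) p * ev Δ (-rt Δ) q) * h1 + h2
  have hN' : Nm Δ p * Nm Δ q = 1 := by exact_mod_cast hN
  exact Int.eq_one_or_neg_one_of_mul_eq_one hN'

/-- The inverse of a unit is a unit, and products of units are units. [folklore] -/
theorem IsUnitO.omul {Δ : ℕ} {p q : ℤ × ℤ} (hp : IsUnitO Δ p) (hq : IsUnitO Δ q) : IsUnitO Δ (omul Δ p q) := by
  obtain ⟨p', hp'⟩ := hp
  obtain ⟨q', hq'⟩ := hq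
  refine ⟨Infra.omul Δ p' q', ?_⟩
  -- `(pq)(p'q') = (pp')(qq') = 1`, by evaluation-free ring identities
  have : Infra.omul Δ (Infra.omul Δ p q) (Infra.omul Δ p' q') =
      Infra.omul Δ (Infra.omul Δ p p') (Infra.omul Δ q q') := by
    unfold Infra.omul; ext <;> simp only <;> ring
  rw [this, hp', hq']
  unfold Infra.omul; simp

/-- `√d` is irrational for squarefree `d ≥ 2`. [folklore] -/
theorem not_isSquare_of_squarefree (hd : Squarefree d) (h2 : 2 ≤ d) : ¬ IsSquare d := by
  rintro ⟨k, hk⟩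
  have : Squarefree (k * k) := hk ▸ hd
  have hk1 := Nat.isUnit_iff.mp (this k (dvd_refl _))
  subst hk1; omega

/-- Rational and irrational parts for `√d`. [folklore] -/
theorem int_add_int_mul_sqrt (hd : Squarefree d) (h2 : 2 ≤ d) {P Q : ℤ} (h : (P : ℝ) + Q * Real.sqrt d = 0) :
    P = 0 ∧ Q = 0 := by
  by_cases hQ : Q = 0
  · subst hQ; simp at h; exact ⟨by exact_mod_cast h, rfl⟩
  · exfalso
    have hQ' : (Q : ℝ) ≠ 0 := by exact_mod_cast hQ
    have : Real.sqrt d = ((-P : ℤ) : ℝ) / ((Q : ℤ) : ℝ) := by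
      rw [eq_div_iff hQ']; push_cast; linarith
    exact (irrational_iff_ne_rational _).mp
      (irrational_sqrt_natCast_iff.mpr (not_isSquare_of_squarefree hd h2)) _ _ hQ this

/-- **Every unit `u > 1` is `(x + y√d)/2` with `x, y ≥ 1`, `x² - dy² = ±4`.**
[cite: JacobsonWilliams2008, §1.3–1.4 (units of a real quadratic field)] -/
theorem pair_of_unit (hd : Squarefree d) (h2 : 2 ≤ d) {p : ℤ × ℤ} (hu : IsUnitO (disc d) p)
    (h1 : 1 < ev (disc d) (rt (disc d)) p) :
    1 ≤ pairX d p ∧ 1 ≤ pairY d p ∧ IsUnitPair d (pairX d p) (pairY d p) := by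
  have hΔ := disc_isDisc hd h2
  have hN := hu.nm_eq hΔ
  have hprod := ev_mul_ev_neg hΔ p
  have hpn := pair_norm hd h2 p
  rw [ev_eq_pair] at h1 hprod
  rw [ev_neg_eq_pair] at hprod
  have hsd : 0 < Real.sqrt d := Real.sqrt_pos.mpr (by exact_mod_cast (show 0 < d by omega))
  -- `|η'| < 1` because `η η' = ±1` and `η > 1`
  have hη' : |((pairX d p : ℝ) - pairY d p * Real.sqrt d) / 2| < 1 := by
    have habs : |((pairX d p : ℝ) + pairY d p * Real.sqrt d) / 2| *
        |((pairX d p : ℝ) - pairY d p * Real.sqrt d) / 2| = 1 := by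
      rw [← abs_mul, hprod]
      rcases hN with h | h <;> simp [h]
    have hη : 1 < |((pairX d p : ℝ) + pairY d p * Real.sqrt d) / 2| := lt_of_lt_of_le h1 (le_abs_self _)
    by_contra hc
    push Not at hc
    nlinarith [abs_nonneg (((pairX d p : ℝ) - pairY d p * Real.sqrt d) / 2)]
  rw [abs_lt] at hη'
  obtain ⟨hlo, hhi⟩ := hη'
  refine ⟨?_, ?_, ?_⟩
  · exact int_one_le_of_pos (by linarith)
  · have hY : (0 : ℝ) < pairY d p := by
      by_contra hc
      push Not at hc
      nlinarith
    exact int_one_le_of_pos hY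
  · unfold IsUnitPair
    rcases hN with h | h
    · left; rw [hpn, h]; ring
    · right; rw [hpn, h]; ring

/-- Squares modulo `4`: `x² ≡ 0` with `x` even, or `x² ≡ 1` with `x` odd. [folklore] -/
theorem sq_mod_four (x : ℤ) : (x ^ 2 % 4 = 0 ∧ x % 2 = 0) ∨ (x ^ 2 % 4 = 1 ∧ x % 2 = 1) := by
  rcases Int.even_or_odd x with ⟨k, hk⟩ | ⟨k, hk⟩
  · left
    have : x ^ 2 = 4 * (k * k) := by rw [hk]; ring
    generalize k * k = K at this
    omega
  · right
    have : x ^ 2 = 4 * (k * k + k) + 1 := by rw [hk]; ring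
    generalize k * k + k = K at this
    omega

/-- **A unit pair gives a unit of `𝒪_Δ`** with `X = a`, `Y = b` (parity: `a ≡ b (mod 2)` if
`d ≡ 1 (mod 4)`; `a, b` even if `d ≡ 2, 3 (mod 4)`). [cite: JacobsonWilliams2008, §1.3–1.4, §4.1] -/
theorem unit_of_pair (hd : Squarefree d) (h2 : 2 ≤ d) {a b : ℤ} (hp : IsUnitPair d a b) :
    ∃ u : ℤ × ℤ, pairX d u = a ∧ pairY d u = b ∧ IsUnitO (disc d) u := by
  have h4 := mod_four_ne_zero hd
  have hab : (a ^ 2 - d * b ^ 2) % 4 = 0 := by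
    unfold IsUnitPair at hp; rcases hp with h | h <;> omega
  -- the coordinates, by cases on `d mod 4`
  have key : ∃ u : ℤ × ℤ, pairX d u = a ∧ pairY d u = b := by
    unfold pairX pairY discK
    rw [sig_disc]
    have hdb : ((d : ℤ) * b ^ 2) % 4 = ((d : ℤ) % 4) * (b ^ 2 % 4) % 4 := Int.mul_emod _ _ _
    by_cases h1 : d % 4 = 1
    · -- `a ≡ b (mod 2)`
      simp only [h1, if_true]
      have hd1 : (d : ℤ) % 4 = 1 := by exact_mod_cast h1
      have hpar : (a - b) % 2 = 0 := by
        rcases sq_mod_four a with ⟨ha, ha'⟩ | ⟨ha, ha'⟩ <;>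
          rcases sq_mod_four b with ⟨hb, hb'⟩ | ⟨hb, hb'⟩ <;>
          · rw [hb, hd1] at hdb; norm_num at hdb; omega
      refine ⟨((a - b) / 2, b), ?_, ?_⟩
      · push_cast; omega
      · push_cast; ring
    · -- `a, b` even
      simp only [h1, if_false]
      have hd23 : (d : ℤ) % 4 = 2 ∨ (d : ℤ) % 4 = 3 := by omega
      have hb : b % 2 = 0 := by
        rcases sq_mod_four b with ⟨hb, hb'⟩ | ⟨hb, hb'⟩
        · exact hb'
        · exfalso
          rw [hb] at hdb
          rcases sq_mod_four a with ⟨ha, _⟩ | ⟨ha, _⟩ <;> rcases hd23 with hd' | hd' <;>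
          · rw [hd'] at hdb; norm_num at hdb; omega
      have ha : a % 2 = 0 := by
        rcases sq_mod_four a with ⟨ha, ha'⟩ | ⟨ha, ha'⟩
        · exact ha'
        · exfalso
          rcases sq_mod_four b with ⟨hb2, _⟩ | ⟨hb2, hb2'⟩
          · rw [hb2] at hdb; norm_num at hdb; omega
          · omega
      refine ⟨(a / 2, b / 2), ?_, ?_⟩
      · push_cast; omega
      · push_cast; omega
  obtain ⟨u, hX, hY⟩ := key
  refine ⟨u, hX, hY, isUnitO_of_nm ?_⟩
  have hn := pair_norm hd h2 u
  rw [hX, hY] at hn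
  unfold IsUnitPair at hp
  rcases hp with h | h
  · left; linarith
  · right; linarith

/-- **Traces grow under multiplication by a unit `> 1`**: if `2a₀ = a'x + db'y` for unit pairs
`(a', b')`, `(x, y)` with `a', b', x, y ≥ 1`, then `a' < a₀` (the case `x = 1` forces `d = 5`,
`y = 1`, and then `a' < 5b'`). [cite: JacobsonWilliams2008, §1.4 (powers of the fundamental unit)] -/
theorem lt_of_trace (h2 : 2 ≤ d) {a₀ a' b' x y : ℤ} (ha' : 1 ≤ a') (hb' : 1 ≤ b') (hx : 1 ≤ x)
    (hy : 1 ≤ y) (hxy : IsUnitPair d x y) (hab : IsUnitPair d a' b')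
    (htr : 2 * a₀ = a' * x + d * b' * y) : a' < a₀ := by
  have hd : (2 : ℤ) ≤ d := by exact_mod_cast h2
  rcases lt_or_eq_of_le hx with hx2 | hx1
  · -- `x ≥ 2`
    have h1 : (1 : ℤ) ≤ b' * y := by nlinarith
    have h2' : (2 : ℤ) ≤ d * (b' * y) := by nlinarith
    have h3 : (0 : ℤ) ≤ a' * (x - 2) := mul_nonneg (by linarith) (by linarith)
    nlinarith
  · -- `x = 1`: then `dy² = 5`, so `d = 5`, `y = 1`
    subst hx1
    unfold IsUnitPair at hxy hab
    have hdy : (d : ℤ) * y ^ 2 = 5 := by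
      rcases hxy with h | h
      · nlinarith
      · linarith
    have hy1 : y = 1 := by
      by_contra hne
      have : 2 ≤ y := by omega
      nlinarith
    subst hy1
    have hd5 : (d : ℤ) = 5 := by linarith
    rw [hd5] at hab htr
    -- `a'² ≤ 5b'² + 4 < 25 b'²`
    have hsq : a' ^ 2 ≤ 5 * b' ^ 2 + 4 := by rcases hab with h | h <;> linarith
    have : a' < 5 * b' := by nlinarith
    linarith

/-- `x² ≡ x (mod 2)` helper in the form used by `omega`. [folklore] -/
theorem one_le_of_isUnitPair (hd : Squarefree d) (h2 : 2 ≤ d) {a b : ℕ} (hb : 0 < b)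
    (hp : IsUnitPair d a b) : 1 ≤ a := by
  by_contra h
  have ha : a = 0 := by omega
  subst ha
  unfold IsUnitPair at hp
  push_cast at hp
  have hb1 : (1 : ℤ) ≤ b := by exact_mod_cast hb
  have hd2 : (2 : ℤ) ≤ d := by exact_mod_cast h2
  rcases hp with h | h
  · nlinarith
  · -- `d b² = 4` with `d ≥ 2` squarefree: `d = 4` or `b = 2, d = 1` — impossible
    have h4 := mod_four_ne_zero hd
    have : (d : ℤ) * b ^ 2 = 4 := by linarith
    have hb2 : b ≤ 2 := by
      by_contra hc
      have : (3 : ℤ) ≤ b := by exact_mod_cast (show 3 ≤ b by omega)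
      nlinarith
    interval_cases b
    · norm_num at this; omega
    · norm_num at this; omega

/-- **The unit pair with least `a` is the fundamental unit**: for `ε₀ = (a + b√d)/2` with `(a, b)` a
unit pair, `b > 0`, `a` least among all unit pairs with positive second entry, every unit `u` of
`𝒪_Δ` with `|u| > 1` satisfies `|u| ≥ ε₀`. [cite: JacobsonWilliams2008, §1.4 (fundamental unit)] -/
theorem least_of_least_trace (hd : Squarefree d) (h2 : 2 ≤ d) {a b : ℕ}
    (hp : IsUnitPair d a b)
    (hmin : ∀ a' b' : ℕ, 0 < b' → IsUnitPair d a' b' → a ≤ a')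
    {u₀ : ℤ × ℤ} (hX : pairX d u₀ = a) (hY : pairY d u₀ = b)
    {p : ℤ × ℤ} (hu : IsUnitO (disc d) p) (h1 : 1 < ev (disc d) (rt (disc d)) p) :
    ev (disc d) (rt (disc d)) u₀ ≤ ev (disc d) (rt (disc d)) p := by
  have hΔ := disc_isDisc hd h2
  have hu₀ : IsUnitO (disc d) u₀ := by
    obtain ⟨u, hX', hY', hu'⟩ := unit_of_pair hd h2 hp
    have : u = u₀ := by
      have h1 : u.2 = u₀.2 := by
        unfold pairY at hY hY'
        have hk : (discK d : ℤ) ≠ 0 := by unfold discK; split_ifs <;> norm_num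
        exact mul_left_cancel₀ hk (by rw [hY, hY'])
      unfold pairX at hX hX'
      ext
      · rw [h1] at hX'; linarith
      · exact h1
    rw [← this]; exact hu'
  by_contra hlt
  push Not at hlt
  -- `w = u₀ / p` is a unit `> 1`
  obtain ⟨q, hq⟩ := hu
  have hq_unit : IsUnitO (disc d) q := ⟨p, by rw [omul_comm]; exact hq⟩
  have hp_unit : IsUnitO (disc d) p := ⟨q, hq⟩
  set w := omul (disc d) u₀ q with hw
  have hw_unit : IsUnitO (disc d) w := hu₀.omul hq_unit
  have hpq : ev (disc d) (rt (disc d)) p * ev (disc d) (rt (disc d)) q = 1 := by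
    rw [← ev_omul hΔ (rt_sq _), hq, ev_one]
  have hp0 : 0 < ev (disc d) (rt (disc d)) p := by linarith
  have hw_ev : ev (disc d) (rt (disc d)) w * ev (disc d) (rt (disc d)) p = ev (disc d) (rt (disc d)) u₀ := by
    rw [hw, ev_omul hΔ (rt_sq _)]; linear_combination ev (disc d) (rt (disc d)) u₀ * hpq
  have hw1 : 1 < ev (disc d) (rt (disc d)) w := by
    by_contra hc; push Not at hc
    nlinarith
  -- pairs of `p` and `w`
  obtain ⟨ha', hb', hab⟩ := pair_of_unit hd h2 hp_unit h1
  obtain ⟨hx, hy, hxy⟩ := pair_of_unit hd h2 hw_unit hw1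
  -- `2a = a'x + d b'y` by comparing rational parts of `u₀ = p · w`
  have htr : 2 * (a : ℤ) = pairX d p * pairX d w + d * pairY d p * pairY d w := by
    have h := hw_ev
    rw [ev_eq_pair, ev_eq_pair, ev_eq_pair, hX, hY] at h
    have hsq : Real.sqrt d * Real.sqrt d = d := Real.mul_self_sqrt (Nat.cast_nonneg d)
    have h0 : (((pairX d p * pairX d w + d * pairY d p * pairY d w - 2 * a : ℤ) : ℝ)) +
        ((pairX d p * pairY d w + pairY d p * pairX d w - 2 * b : ℤ) : ℝ) * Real.sqrt d = 0 := by
      push_cast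
      linear_combination 4 * h - ((pairY d p : ℝ) * pairY d w) * hsq
    have := (int_add_int_mul_sqrt hd h2 h0).1
    linarith
  have hlt' := lt_of_trace h2 ha' hb' hx hy hxy hab htr
  -- but `a` is least
  have hmin' := hmin (pairX d p).toNat (pairY d p).toNat (by omega) (by
    rw [Int.toNat_of_nonneg (by omega), Int.toNat_of_nonneg (by omega)]; exact hab)
  have : (a : ℤ) ≤ pairX d p := by omega
  linarith

/-- `ε₀ = (a + b√d)/2 > 1`. [folklore] -/
theorem one_lt_eps (hd : Squarefree d) (h2 : 2 ≤ d) {a b : ℕ} (hb : 0 < b) (hp : IsUnitPair d a b) :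
    1 < ((a : ℝ) + b * Real.sqrt d) / 2 := by
  have ha : (1 : ℝ) ≤ a := by exact_mod_cast one_le_of_isUnitPair hd h2 hb hp
  have hb1 : (1 : ℝ) ≤ b := by exact_mod_cast hb
  have hs : 1 < Real.sqrt d := by
    rw [show (1 : ℝ) = Real.sqrt 1 by simp]
    exact Real.sqrt_lt_sqrt (by norm_num) (by exact_mod_cast (show 1 < d by omega))
  nlinarith

/-- **Least-unit property in absolute value**: every unit `u` with `|u| > 1` has `|u| ≥ ε₀`.
[cite: JacobsonWilliams2008, §1.4 (fundamental unit)] -/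
theorem least_abs (hd : Squarefree d) (h2 : 2 ≤ d) {a b : ℕ} (hp : IsUnitPair d a b)
    (hmin : ∀ a' b' : ℕ, 0 < b' → IsUnitPair d a' b' → a ≤ a')
    {u₀ : ℤ × ℤ} (hX : pairX d u₀ = a) (hY : pairY d u₀ = b)
    {p : ℤ × ℤ} (hu : IsUnitO (disc d) p) (h1 : 1 < |ev (disc d) (rt (disc d)) p|) :
    ev (disc d) (rt (disc d)) u₀ ≤ |ev (disc d) (rt (disc d)) p| := by
  rcases lt_or_ge 0 (ev (disc d) (rt (disc d)) p) with hpos | hneg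
  · rw [abs_of_pos hpos] at h1 ⊢
    exact least_of_least_trace hd h2 hp hmin hX hY hu h1
  · rw [abs_of_nonpos hneg] at h1 ⊢
    have := least_of_least_trace hd h2 hp hmin hX hY hu.neg (by rw [ev_neg]; exact h1)
    rwa [ev_neg] at this

end Literature.NumberTheory.QuadraticFields.Infra

end
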